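import Mathlib.Analysis.Complex.Conformal
import Mathlib.Analysis.Complex.UpperHalfPlane.Manifold
import Mathlib.Analysis.SpecialFunctions.Sqrt
import Mathlib.Analysis.SpecialFunctions.Trigonometric.Series
import Mathlib.Analysis.SpecialFunctions.ExpDeriv
import Literature.NumberTheory.Automorphic.NewformAdelisationDescent
import Literature.NumberTheory.Automorphic.ArchimedeanCalculusRegular
import HarnessLib

/-!
# Adelisation of classical modular forms, IV: holomorphy and cuspidality of the descent `φ ↦ f_φ`
(Gelbart 1997, (2.5.4) (v)–(vii), converse direction; Bump 1997, Prop. 2.2.5)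

Topic `NumberTheory/Automorphic`; sequel of `NewformAdelisationDescent` (the descent
`f_φ(τ) = φ((g_τ, 1)) (√y)^{-k}`, `g_τ = (y x; 0 1)`, of a left `GL₂(ℚ)`-invariant, right
`K₁(N)`-invariant function `φ` on `GL₂(𝔸_ℚ)` of weight `k` at `∞`, packaged there as a
`SlashInvariantForm (Gamma1 N) k`). This file supplies the two *analytic* conditions of the
dictionary `f ↔ φ_f` of Gelbart 1997, Prop. 2.5 (sketch of proof, (2.5.4), p. 170) in the
direction `φ ↦ f_φ` — holomorphy and vanishing at the cusps — and packages the descent as a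
Mathlib `CuspForm (Gamma1 N) k`. Everything is proved; there are no named facts.

* `GL2Real.hasFDerivAt_comp_upperHalfPlaneToGL` — for `F : GL₂(ℝ) → ℂ` smooth in the archimedean
  variable (`IsArchSmooth` for the full linear real group `RealMatrixGroup.gl ℝ (Fin 2)`), the map
  `τ ↦ F(g_τ)` is real-differentiable with differential `v ↦ y⁻¹ ((im v) E₁₁F + (re v) E₁₂F)(g_τ)`,
  i.e. `(E₁₂ F)(g_τ) = y ∂_x` and `(E₁₁ F)(g_τ) = y ∂_y` of `F(g_τ)` (Bump 1997, proof of Prop. 2.2.5: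
  "`(dR̂ f)(g) = d/dt f(g exp(tR̂))|_{t=0} = y ∂f/∂x (g)`"). The chart is `g_z = g_τ exp(log(g_τ⁻¹ g_z))`
  with the smooth local logarithm of `ArchimedeanCalculusRegular`.
* `GL2Real.mdifferentiableAt_archDescent_iff` — **holomorphy criterion**: `f_F = archDescent k F` is
  complex-differentiable at `τ` iff `(E₁₁ F)(g_τ) - i (E₁₂ F)(g_τ) = (k/2) F(g_τ)` (Cauchy–Riemann,
  Mathlib `differentiableAt_complex_iff_differentiableAt_real`); for `F` of weight `k` this is the
  vanishing at `g_τ` of the Maass lowering operator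
  `dL = e^{-2iθ}(-iy ∂_x + y ∂_y - (1/2i) ∂_θ)` (Bump 1997, (2.32); Exercise 2.1.7 (a): `y^{k/2} f`
  is annihilated by `L_k` for `f` holomorphic of weight `k`), i.e. Gelbart's condition (2.5.4) (v),
  "`X · φ = 0`, `X = (1 -i; -i -1)`", read on `GL₂(ℝ)⁺`; `GL2Real.mdifferentiable_archDescent`.
* `slash_archDescent_eq`, `isZeroAtImInfty_archDescent`, `isZeroAtImInfty_archDescent_slash` —
  `f_F ∣[k] γ = f_{F(γ ·)}` for `det γ = 1`, and **a function bounded on `GL₂(ℝ)⁺` descends, in weight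
  `k > 0`, to a function vanishing at every cusp** (`‖f_F(τ)‖ = ‖F(g_τ)‖ (√y)^{-k}`); this replaces
  the growth and cuspidality conditions (vi)–(vii) of (2.5.4) by the boundedness of `φ`, which cusp
  forms on `GL₂(𝔸_ℚ)` enjoy (Gelbart 1975, Prop. 3.1: "`φ_f` is bounded"; in the tree
  `AutomorphicRepsGL.cuspidal_bounded`, proved in `CuspFormsBoundedHC`).
* `GL2Real.exp_smul_rotGen`, `GL2Real.expGL_smul_one`, `GL2Real.lieDeriv_rotGen_of_hasArchWeight`,
  `GL2Real.lieDeriv_one_of_hasArchWeight` — `exp(θW) = cos θ · 1 + sin θ · W` for `W = (0 1; -1 0)`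
  (Bump 1997, (2.36)) and `exp(t · 1) = e^t · 1`, whence a function of weight `k` on `GL₂(ℝ)⁺`
  satisfies `W F = ik F` and `Z F = 0`; `GL2Real.lowering` — Gelbart's operator
  `X = (1 -i; -i -1) = (E₁₁ - E₂₂) - i(E₁₂ + E₂₁)` (twice Bump's `L`, (2.23)) as a complexified Lie
  derivative; `GL2Real.lowering_eq_of_hasArchWeight` — on weight-`k` functions
  `X F = 2(E₁₁F - iE₁₂F) - kF`; hence `GL2Real.mdifferentiableAt_archDescent_iff_lowering`:
  **`f_F` is holomorphic at `τ` iff `(X F)(g_τ) = 0`**, and `GL2Real.mdifferentiable_archDescent_of_lowering`.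
* `adelicDescentCuspForm N k` — **the cusp form `f_φ ∈ S_k(Γ₁(N))` of an adelic `φ`** satisfying
  (i) left `GL₂(ℚ)`-invariance, (ii) right `K₁(N)`-invariance, (iii)–(iv) weight `k > 0` at `∞`,
  (v) `X · φ = 0` on `GL₂(ℝ)⁺ × {1}` (with `F_φ = φ ∘ (g_∞ ↦ (g_∞, 1))` smooth in the archimedean
  variable), and boundedness on `GL₂(ℝ)⁺ × {1}`; `adelicLiftFun_adelicDescentCuspForm` — its adelic
  lift is `φ` again (`φ ↦ f_φ ↦ φ_{f_φ} = φ`).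

What is *not* here: the transport of (v) from the tree's Lie derivatives
`lieDeriv (AutomorphyDatum.gl 2 ℚ hcpt).ofArch X φ` along the archimedean group `GL₂(mixedSpace ℚ)` of
the `GL₂/ℚ` automorphy datum to `GL₂(ℝ)` (`ℝ = ℚ_∞ ≅ mixedSpace ℚ`), the Hecke equivariance of
`φ ↦ f_φ`, and the extraction of a weight-`k` vector from an automorphic representation (Gelbart 1997,
Prop. 2.5, converse direction proper).

## References

* S. Gelbart, *Three lectures on the modularity of `ρ̄_{E,3}` and the Langlands reciprocity
  conjecture*, in *Modular Forms and Fermat's Last Theorem* (1997), Prop. 2.5 and its sketch of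
  proof, (2.5.4) (i)–(vii), p. 170 [Gelbart1997].
* S. Gelbart, *Automorphic forms on adele groups*, Ann. of Math. Stud. 83 (1975), §3.A, (3.4)–(3.5),
  Prop. 3.1 [Gelbart1975].
* D. Bump, *Automorphic Forms and Representations* (1997), §2.1 (Maass operators, Exercise 2.1.7)
  and Prop. 2.2.5 with (2.28)–(2.33) [Bump1997].
* A. Borel, H. Jacquet, *Automorphic forms and automorphic representations*, Proc. Sympos. Pure
  Math. 33 (1979), Part 1, §1.1, §1.5 [BorelJacquetCorvallis1979].
-/

noncomputable section

open scoped MatrixGroups Matrix ContDiff Topology Manifold ModularForm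
open Filter UpperHalfPlane

namespace Literature.NumberTheory.Automorphic

-- Mathlib idiom (Mathlib/Algebra/Lie/OfAssociative.lean); needed to mention Lie subalgebras of matrix algebras
attribute [local instance 100] LieRing.ofAssociativeRing

namespace GL2Real

/-- `GL₂(ℝ)` as a linear real group (all of `GL (Fin 2) ℝ`, Lie algebra all of `𝔤𝔩₂(ℝ)`). [folklore] -/
abbrev grp : RealMatrixGroup ℝ (Fin 2) := RealMatrixGroup.gl ℝ (Fin 2)

/-- The inclusion of (the carrier `⊤` of) `GL₂(ℝ)` in `GL (Fin 2) ℝ`, along which Lie derivatives of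
functions on `GL (Fin 2) ℝ` are taken. [folklore] -/
abbrev incl : (RealMatrixGroup.gl ℝ (Fin 2)).carrier →* GL (Fin 2) ℝ :=
  (RealMatrixGroup.gl ℝ (Fin 2)).carrier.subtype

/-- A matrix as an element of the Lie algebra `𝔤𝔩₂(ℝ) = ⊤`. [folklore] -/
def toLie (M : Matrix (Fin 2) (Fin 2) ℝ) : (RealMatrixGroup.gl ℝ (Fin 2)).lie :=
  ⟨M, LieSubalgebra.mem_top M⟩

/-- The matrix underlying `toLie M` is `M`. [folklore] -/
@[simp] theorem coe_toLie (M : Matrix (Fin 2) (Fin 2) ℝ) :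
    ((toLie M : (RealMatrixGroup.gl ℝ (Fin 2)).lie) : Matrix (Fin 2) (Fin 2) ℝ) = M := rfl

/-- The matrix unit `E₁₁ = (1 0; 0 0)`. [folklore] -/
def e₁₁ : Matrix (Fin 2) (Fin 2) ℝ := !![1, 0; 0, 0]
/-- The matrix unit `E₁₂ = (0 1; 0 0)` (raising nilpotent). [folklore] -/
def e₁₂ : Matrix (Fin 2) (Fin 2) ℝ := !![0, 1; 0, 0]
/-- The matrix unit `E₂₁ = (0 0; 1 0)`. [folklore] -/
def e₂₁ : Matrix (Fin 2) (Fin 2) ℝ := !![0, 0; 1, 0]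
/-- The matrix unit `E₂₂ = (0 0; 0 1)`. [folklore] -/
def e₂₂ : Matrix (Fin 2) (Fin 2) ℝ := !![0, 0; 0, 1]

/-- The section `z = x + iy ↦ (y x; 0 1)` of `g ↦ g · i`, as a matrix-valued function on all of `ℂ`
(it is `upperHalfPlaneToGL` on the upper half plane). [folklore] -/
def secMat (z : ℂ) : Matrix (Fin 2) (Fin 2) ℝ := !![z.im, z.re; 0, 1]

/-- `(y x; 0 1) = y E₁₁ + x E₁₂ + E₂₂`. [folklore] -/
theorem secMat_eq (z : ℂ) : secMat z = z.im • e₁₁ + z.re • e₁₂ + e₂₂ := by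
  ext i j
  fin_cases i <;> fin_cases j <;> simp [secMat, e₁₁, e₁₂, e₂₂]

/-- The matrix of `g_τ` is `secMat τ`. [folklore] -/
theorem coe_upperHalfPlaneToGL (τ : ℍ) :
    ((upperHalfPlaneToGL τ : GL (Fin 2) ℝ) : Matrix (Fin 2) (Fin 2) ℝ) = secMat (τ : ℂ) := rfl

/-- `g_τ E₁₁ = y E₁₁`. [folklore] -/
theorem upperHalfPlaneToGL_mul_e₁₁ (τ : ℍ) :
    ((upperHalfPlaneToGL τ : GL (Fin 2) ℝ) : Matrix (Fin 2) (Fin 2) ℝ) * e₁₁ = τ.im • e₁₁ := by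
  rw [coe_upperHalfPlaneToGL]
  ext i j
  fin_cases i <;> fin_cases j <;> simp [secMat, e₁₁, Matrix.mul_apply, Fin.sum_univ_two]

/-- `g_τ E₁₂ = y E₁₂`. [folklore] -/
theorem upperHalfPlaneToGL_mul_e₁₂ (τ : ℍ) :
    ((upperHalfPlaneToGL τ : GL (Fin 2) ℝ) : Matrix (Fin 2) (Fin 2) ℝ) * e₁₂ = τ.im • e₁₂ := by
  rw [coe_upperHalfPlaneToGL]
  ext i j
  fin_cases i <;> fin_cases j <;> simp [secMat, e₁₂, Matrix.mul_apply, Fin.sum_univ_two]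


/-- Real derivative of the section: `d secMat (z) v = (im v) E₁₁ + (re v) E₁₂`. [folklore] -/
def secMatDeriv : ℂ →L[ℝ] Matrix (Fin 2) (Fin 2) ℝ :=
  Complex.imCLM.smulRight e₁₁ + Complex.reCLM.smulRight e₁₂

/-- Unfolding `secMatDeriv`. [folklore] -/
@[simp] theorem secMatDeriv_apply (v : ℂ) : secMatDeriv v = v.im • e₁₁ + v.re • e₁₂ := rfl

set_option backward.isDefEq.respectTransparency false in
open scoped Matrix.Norms.Operator in
/-- The section `z ↦ (im z, re z; 0, 1)` is real-differentiable (it is real-affine). [folklore] -/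
theorem hasFDerivAt_secMat (z : ℂ) : HasFDerivAt secMat secMatDeriv z := by
  have h : HasFDerivAt (fun w : ℂ => w.im • e₁₁ + w.re • e₁₂ + e₂₂) secMatDeriv z := by
    have h1 := (Complex.imCLM.hasFDerivAt (x := z)).smul_const e₁₁
    have h2 := (Complex.reCLM.hasFDerivAt (x := z)).smul_const e₁₂
    exact (h1.add h2).add_const e₂₂
  refine h.congr_of_eventuallyEq (Eventually.of_forall fun w => ?_)
  exact secMat_eq w


set_option backward.isDefEq.respectTransparency false in
open scoped Matrix.Norms.Operator in
/-- The slices `M ↦ F (g · exp M)` of an archimedean-smooth `F` on `GL₂(ℝ)` are `C^∞` on all of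
`𝔤𝔩₂(ℝ)` (unpacking `IsArchSmooth` for the full linear group, whose Lie algebra is `⊤`).
Borel–Jacquet 1979, §1.1. [folklore] -/
theorem contDiff_slice {F : GL (Fin 2) ℝ → ℂ} (hs : IsArchSmooth incl F) (g : GL (Fin 2) ℝ) :
    ContDiff ℝ ∞ fun M : Matrix (Fin 2) (Fin 2) ℝ => F (g * expGL M) := by
  let inc : Matrix (Fin 2) (Fin 2) ℝ →ₗ[ℝ] (RealMatrixGroup.gl ℝ (Fin 2)).lie.toSubmodule :=
    LinearMap.codRestrict _ LinearMap.id fun M => LieSubalgebra.mem_top M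
  have hinc : ContDiff ℝ ∞ (inc : Matrix (Fin 2) (Fin 2) ℝ → _) :=
    (⟨inc, inc.continuous_of_finiteDimensional⟩ :
      Matrix (Fin 2) (Fin 2) ℝ →L[ℝ] (RealMatrixGroup.gl ℝ (Fin 2)).lie.toSubmodule).contDiff
  exact (hs g).comp hinc

set_option backward.isDefEq.respectTransparency false in
open scoped Matrix.Norms.Operator in
/-- The Lie derivative along `M ∈ 𝔤𝔩₂(ℝ)` of an archimedean-smooth `F` is the differential at `0` of
the slice `M' ↦ F (g · exp M')` evaluated at `M`. Borel–Jacquet 1979, §1.5. [folklore] -/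
theorem lieDeriv_toLie_eq_fderiv {F : GL (Fin 2) ℝ → ℂ} (hs : IsArchSmooth incl F)
    (M : Matrix (Fin 2) (Fin 2) ℝ) (g : GL (Fin 2) ℝ) :
    lieDeriv incl (toLie M) F g =
      fderiv ℝ (fun M' : Matrix (Fin 2) (Fin 2) ℝ => F (g * expGL M')) 0 M := by
  set Ψ : Matrix (Fin 2) (Fin 2) ℝ → ℂ := fun M' => F (g * expGL M') with hΨ_def
  have hΨd : HasFDerivAt Ψ (fderiv ℝ Ψ 0) ((fun t : ℝ => t • M) 0) := by
    rw [show (fun t : ℝ => t • M) 0 = 0 from zero_smul _ _]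
    exact ((contDiff_slice hs g).differentiable (by simp)).differentiableAt.hasFDerivAt
  have hline : HasDerivAt (fun t : ℝ => t • M) M 0 := by
    simpa using (hasDerivAt_id (0 : ℝ)).smul_const M
  exact (hΨd.comp_hasDerivAt (0 : ℝ) hline).deriv

set_option backward.isDefEq.respectTransparency false in
open scoped Matrix.Norms.Operator in
/-- **The section `τ ↦ F(g_τ)` is real-differentiable, with differential
`v ↦ y⁻¹ ((im v) (E₁₁ F)(g_τ) + (re v) (E₁₂ F)(g_τ))`** for `F` archimedean-smooth on `GL₂(ℝ)`
(`g_τ = (y x; 0 1)`; near `τ` one has `g_z = g_τ exp (log (g_τ⁻¹ g_z))` with `log` the smooth local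
logarithm, and `g_τ⁻¹ ∂_x g_z = y⁻¹ E₁₂`, `g_τ⁻¹ ∂_y g_z = y⁻¹ E₁₁`; equivalently
`(E₁₂ F)(g_τ) = y ∂_x F(g_τ)` and `(E₁₁ F)(g_τ) = y ∂_y F(g_τ)`, Bump 1997, proof of Prop. 2.2.5).
[cite: Bump1997, Prop. 2.2.5 (proof)] -/
theorem hasFDerivAt_comp_upperHalfPlaneToGL {F : GL (Fin 2) ℝ → ℂ} (hs : IsArchSmooth incl F) (τ : ℍ) :
    HasFDerivAt (fun z : ℂ => F (upperHalfPlaneToGL (ofComplex z)))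
      ((τ.im)⁻¹ • ((Complex.imCLM).smulRight (lieDeriv incl (toLie e₁₁) F (upperHalfPlaneToGL τ)) +
        (Complex.reCLM).smulRight (lieDeriv incl (toLie e₁₂) F (upperHalfPlaneToGL τ)))) (τ : ℂ) := by
  set g₀ : GL (Fin 2) ℝ := upperHalfPlaneToGL τ with hg₀
  -- the smooth slice at `g₀`
  set Ψ : Matrix (Fin 2) (Fin 2) ℝ → ℂ := fun M => F (g₀ * expGL M) with hΨ_def
  have hΨ : ContDiff ℝ ∞ Ψ := contDiff_slice hs g₀
  have hΨd : HasFDerivAt Ψ (fderiv ℝ Ψ 0) 0 :=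
    ((hΨ.differentiable (by simp)).differentiableAt).hasFDerivAt
  -- the smooth local logarithm and its differential at `1`
  obtain ⟨log, hlogC, hlog1, hright, hleft⟩ := exists_contDiffAt_log_inverse (A := ℝ) (N := Fin 2)
  have hlogd : HasFDerivAt log (ContinuousLinearMap.id ℝ _) 1 := by
    have hd : HasFDerivAt log (fderiv ℝ log 1) 1 := (hlogC.differentiableAt (by simp)).hasFDerivAt
    have hexp0 : HasFDerivAt (NormedSpace.exp : Matrix (Fin 2) (Fin 2) ℝ → Matrix (Fin 2) (Fin 2) ℝ)
        (1 : Matrix (Fin 2) (Fin 2) ℝ →L[ℝ] Matrix (Fin 2) (Fin 2) ℝ) 0 :=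
      hasFDerivAt_exp_zero
    have hd' : HasFDerivAt log (fderiv ℝ log 1) (NormedSpace.exp (0 : Matrix (Fin 2) (Fin 2) ℝ)) := by
      rwa [NormedSpace.exp_zero]
    have hcomp : HasFDerivAt (fun x => log (NormedSpace.exp x)) ((fderiv ℝ log 1).comp 1) 0 :=
      hd'.comp 0 hexp0
    have hid : HasFDerivAt (fun x => log (NormedSpace.exp x)) (ContinuousLinearMap.id ℝ _) 0 :=
      (hasFDerivAt_id (0 : Matrix (Fin 2) (Fin 2) ℝ)).congr_of_eventuallyEq hleft
    have heq : (fderiv ℝ log 1).comp 1 = ContinuousLinearMap.id ℝ _ := hcomp.unique hid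
    have hD : fderiv ℝ log 1 = ContinuousLinearMap.id ℝ _ := by
      rw [← heq]; ext1 x; simp
    rwa [hD] at hd
  -- the matrix-valued map `z ↦ g₀⁻¹ g_z`
  set h : ℂ → Matrix (Fin 2) (Fin 2) ℝ :=
    fun z => ((g₀⁻¹ : GL (Fin 2) ℝ) : Matrix (Fin 2) (Fin 2) ℝ) * secMat z with hh_def
  have hhd : HasFDerivAt h (((g₀⁻¹ : GL (Fin 2) ℝ) : Matrix (Fin 2) (Fin 2) ℝ) • secMatDeriv) (τ : ℂ) :=
    (hasFDerivAt_secMat (τ : ℂ)).const_mul _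
  have hh1 : h τ = 1 := by
    simp only [hh_def, ← coe_upperHalfPlaneToGL, ← hg₀, ← Units.val_mul, inv_mul_cancel, Units.val_one]
  have hcont : Tendsto h (𝓝 (τ : ℂ)) (𝓝 1) := by
    rw [← hh1]; exact hhd.continuousAt
  -- near `τ`: `F(g_z) = Ψ (log (g₀⁻¹ g_z))`
  have hev : (fun z : ℂ => F (upperHalfPlaneToGL (ofComplex z))) =ᶠ[𝓝 (τ : ℂ)]
      fun z => Ψ (log (h z)) := by
    filter_upwards [hcont.eventually hright, isOpen_upperHalfPlaneSet.mem_nhds τ.im_pos] with z hz hzim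
    rw [ofComplex_apply_of_im_pos hzim]
    simp only [hΨ_def]
    congr 1
    refine Units.ext ?_
    rw [Units.val_mul, coe_expGL, hz, hh_def]
    dsimp only
    rw [Units.mul_inv_cancel_left]
    rfl
  -- chain rule
  have hmain : HasFDerivAt (fun z => Ψ (log (h z)))
      ((fderiv ℝ Ψ 0).comp ((ContinuousLinearMap.id ℝ _).comp
        (((g₀⁻¹ : GL (Fin 2) ℝ) : Matrix (Fin 2) (Fin 2) ℝ) • secMatDeriv))) (τ : ℂ) := by
    have hlogd' : HasFDerivAt log (ContinuousLinearMap.id ℝ _) (h τ) := by rw [hh1]; exact hlogd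
    have hΨd' : HasFDerivAt Ψ (fderiv ℝ Ψ 0) (log (h τ)) := by rw [hh1, hlog1]; exact hΨd
    exact hΨd'.comp (τ : ℂ) (hlogd'.comp (τ : ℂ) hhd)
  refine (hmain.congr_of_eventuallyEq hev).congr_fderiv ?_
  -- identification of the differential
  have h11 : ((g₀⁻¹ : GL (Fin 2) ℝ) : Matrix (Fin 2) (Fin 2) ℝ) * e₁₁ = (τ.im)⁻¹ • e₁₁ := by
    have h := upperHalfPlaneToGL_mul_e₁₁ τ
    rw [← hg₀] at h
    calc ((g₀⁻¹ : GL (Fin 2) ℝ) : Matrix (Fin 2) (Fin 2) ℝ) * e₁₁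
        = ((g₀⁻¹ : GL (Fin 2) ℝ) : Matrix (Fin 2) (Fin 2) ℝ) * ((τ.im)⁻¹ • ((g₀ : Matrix (Fin 2) (Fin 2) ℝ) * e₁₁)) := by
          rw [h, smul_smul, inv_mul_cancel₀ τ.im_pos.ne', one_smul]
      _ = (τ.im)⁻¹ • e₁₁ := by
          rw [Matrix.mul_smul, ← Matrix.mul_assoc, ← Units.val_mul, inv_mul_cancel, Units.val_one,
            Matrix.one_mul]
  have h12 : ((g₀⁻¹ : GL (Fin 2) ℝ) : Matrix (Fin 2) (Fin 2) ℝ) * e₁₂ = (τ.im)⁻¹ • e₁₂ := by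
    have h := upperHalfPlaneToGL_mul_e₁₂ τ
    rw [← hg₀] at h
    calc ((g₀⁻¹ : GL (Fin 2) ℝ) : Matrix (Fin 2) (Fin 2) ℝ) * e₁₂
        = ((g₀⁻¹ : GL (Fin 2) ℝ) : Matrix (Fin 2) (Fin 2) ℝ) * ((τ.im)⁻¹ • ((g₀ : Matrix (Fin 2) (Fin 2) ℝ) * e₁₂)) := by
          rw [h, smul_smul, inv_mul_cancel₀ τ.im_pos.ne', one_smul]
      _ = (τ.im)⁻¹ • e₁₂ := by
          rw [Matrix.mul_smul, ← Matrix.mul_assoc, ← Units.val_mul, inv_mul_cancel, Units.val_one,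
            Matrix.one_mul]
  have hD11 : fderiv ℝ Ψ 0 e₁₁ = lieDeriv incl (toLie e₁₁) F g₀ := (lieDeriv_toLie_eq_fderiv hs e₁₁ g₀).symm
  have hD12 : fderiv ℝ Ψ 0 e₁₂ = lieDeriv incl (toLie e₁₂) F g₀ := (lieDeriv_toLie_eq_fderiv hs e₁₂ g₀).symm
  ext1 v
  simp only [ContinuousLinearMap.comp_apply, ContinuousLinearMap.id_apply, smul_apply,
    secMatDeriv_apply, add_apply, ContinuousLinearMap.smulRight_apply,
    Complex.imCLM_apply, Complex.reCLM_apply]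
  rw [smul_eq_mul, Matrix.mul_add, Matrix.mul_smul, Matrix.mul_smul, h11, h12, map_add,
    smul_comm v.im, smul_comm v.re, map_smul, map_smul, map_smul, map_smul, hD11, hD12, smul_add]


/-- The archimedean weight factor `z ↦ (√(im z))^{-k}` is real-differentiable on the upper half
plane with differential `v ↦ c' · im v`, `c' = -k (√y)^{-k-1} / (2√y)`. [folklore] -/
theorem hasFDerivAt_sqrt_im_zpow (k : ℤ) {z : ℂ} (hz : 0 < z.im) :
    HasFDerivAt (fun w : ℂ => ((Real.sqrt w.im : ℝ) : ℂ) ^ (-k))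
      (Complex.ofRealCLM.comp
        ((((-k : ℤ) : ℝ) * Real.sqrt z.im ^ (-k - 1) * (1 / (2 * Real.sqrt z.im))) • Complex.imCLM)) z := by
  have hs0 : Real.sqrt z.im ≠ 0 := (Real.sqrt_pos.2 hz).ne'
  have hr : HasDerivAt (fun t : ℝ => Real.sqrt t ^ (-k))
      ((((-k : ℤ) : ℝ) * Real.sqrt z.im ^ (-k - 1)) * (1 / (2 * Real.sqrt z.im))) z.im :=
    (hasDerivAt_zpow (-k) (Real.sqrt z.im) (Or.inl hs0)).comp z.im (Real.hasDerivAt_sqrt hz.ne')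
  have h2 : HasFDerivAt (fun w : ℂ => Real.sqrt w.im ^ (-k))
      ((((-k : ℤ) : ℝ) * Real.sqrt z.im ^ (-k - 1) * (1 / (2 * Real.sqrt z.im))) • Complex.imCLM) z :=
    hr.comp_hasFDerivAt z Complex.imCLM.hasFDerivAt
  have h3 := Complex.ofRealCLM.hasFDerivAt.comp z h2
  refine h3.congr_of_eventuallyEq (Eventually.of_forall fun w => ?_)
  simp only [Function.comp_apply, Complex.ofRealCLM_apply, Complex.ofReal_zpow]

/-- The constant of `hasFDerivAt_sqrt_im_zpow` in closed form: `c' = -(k/2) (√y)^{-k} y⁻¹`. [folklore] -/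
theorem sqrt_zpow_deriv_const_eq (k : ℤ) {y : ℝ} (hy : 0 < y) :
    ((-k : ℤ) : ℝ) * Real.sqrt y ^ (-k - 1) * (1 / (2 * Real.sqrt y)) =
      -((k : ℝ) / 2) * Real.sqrt y ^ (-k) * y⁻¹ := by
  have hs0 : Real.sqrt y ≠ 0 := (Real.sqrt_pos.2 hy).ne'
  rw [zpow_sub_one₀ hs0]
  have hyy : (Real.sqrt y)⁻¹ * (Real.sqrt y)⁻¹ = y⁻¹ := by
    rw [← mul_inv, Real.mul_self_sqrt hy.le]
  rw [← hyy]
  push_cast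
  field_simp

/-- **Holomorphy of the descent is the lowering-operator (Cauchy–Riemann) equation on the section.**
Let `F : GL₂(ℝ) → ℂ` be smooth in the archimedean variable and `f_F = archDescent k F`,
`f_F(τ) = F(g_τ) (√y)^{-k}`. Then `f_F` is complex-differentiable at `τ` iff
`(E₁₁ F)(g_τ) - i (E₁₂ F)(g_τ) = (k/2) F(g_τ)`. Indeed `(E₁₂ F)(g_τ) = y ∂_x F(g_τ)`,
`(E₁₁ F)(g_τ) = y ∂_y F(g_τ)` (`hasFDerivAt_comp_upperHalfPlaneToGL`), so the displayed equation
is `-2iy · y^{k/2} ∂f_F/∂z̄ = 0`; for `F` of weight `k` it is the vanishing at `g_τ` of the Maass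
lowering operator `L = e^{-2iθ}(-iy ∂_x + y ∂_y - (1/2i) ∂_θ)` (Bump 1997, Prop. 2.2.5 and (2.1),
p. 130 and p. 155: `L F = 0` iff `y^{-k/2} F` is holomorphic), i.e. Gelbart's condition
(2.5.4) (v), "`X · φ = 0` where `X = (1 -i; -i -1)`", read on `GL₂(ℝ)⁺`.
[cite: Bump1997, Prop. 2.2.5 and §2.1 (p. 130)] [cite: Gelbart1997, (2.5.4) (v)] -/
theorem mdifferentiableAt_archDescent_iff {k : ℤ} {F : GL (Fin 2) ℝ → ℂ} (hs : IsArchSmooth incl F)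
    (τ : ℍ) :
    MDifferentiableAt 𝓘(ℂ) 𝓘(ℂ) (archDescent k F) τ ↔
      lieDeriv incl (toLie e₁₁) F (upperHalfPlaneToGL τ) -
          Complex.I * lieDeriv incl (toLie e₁₂) F (upperHalfPlaneToGL τ) =
        (k / 2 : ℂ) * F (upperHalfPlaneToGL τ) := by
  have hy0 : 0 < τ.im := τ.im_pos
  -- the real differential of `f_F ∘ ofComplex` at `τ`
  have hΦ := hasFDerivAt_comp_upperHalfPlaneToGL hs τ
  have hc := hasFDerivAt_sqrt_im_zpow k (z := (τ : ℂ)) τ.im_pos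
  have hprod := hΦ.mul hc
  have hev : (archDescent k F ∘ ofComplex) =ᶠ[𝓝 (τ : ℂ)]
      ((fun z : ℂ => F (upperHalfPlaneToGL (ofComplex z))) *
        fun w : ℂ => ((Real.sqrt w.im : ℝ) : ℂ) ^ (-k)) := by
    filter_upwards [isOpen_upperHalfPlaneSet.mem_nhds τ.im_pos] with z hz
    simp only [Function.comp_apply, Pi.mul_apply, archDescent_apply]
    rw [ofComplex_apply_of_im_pos hz]
    rfl
  have hD := hprod.congr_of_eventuallyEq hev
  -- the closed form of the constant `c'`
  have hceq : ((((-k : ℤ) : ℝ) * Real.sqrt τ.im ^ (-k - 1) * (1 / (2 * Real.sqrt τ.im)) : ℝ) : ℂ) =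
      -((k : ℂ) / 2) * (((Real.sqrt τ.im : ℝ) : ℂ) ^ (-k)) * ((τ.im : ℂ))⁻¹ := by
    rw [sqrt_zpow_deriv_const_eq k hy0]
    push_cast
    ring
  have hcw0 : (((Real.sqrt τ.im : ℝ) : ℂ) ^ (-k)) ≠ 0 :=
    zpow_ne_zero _ (by exact_mod_cast (Real.sqrt_pos.2 hy0).ne')
  have hyu0 : ((τ.im : ℂ))⁻¹ ≠ 0 := inv_ne_zero (by exact_mod_cast hy0.ne')
  -- Cauchy–Riemann
  rw [UpperHalfPlane.mdifferentiableAt_iff, differentiableAt_complex_iff_differentiableAt_real,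
    hD.fderiv, and_iff_right hD.differentiableAt]
  simp only [add_apply, smul_apply, ContinuousLinearMap.comp_apply, Complex.ofRealCLM_apply,
    Complex.imCLM_apply, Complex.reCLM_apply, ContinuousLinearMap.smulRight_apply, Complex.I_im,
    Complex.I_re, Complex.one_im, Complex.one_re, zero_smul, one_smul, add_zero, zero_add, mul_zero,
    mul_one, Complex.ofReal_zero, smul_eq_mul, Complex.real_smul, Complex.ofReal_inv, ofComplex_apply,
    UpperHalfPlane.coe_im]
  rw [hceq]
  set A : ℂ := lieDeriv incl (toLie e₁₁) F (upperHalfPlaneToGL τ) with hA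
  set B : ℂ := lieDeriv incl (toLie e₁₂) F (upperHalfPlaneToGL τ) with hB
  set Φ₀ : ℂ := F (upperHalfPlaneToGL τ) with hΦ₀
  set cw : ℂ := ((Real.sqrt τ.im : ℝ) : ℂ) ^ (-k) with hcw
  set u : ℂ := ((τ.im : ℂ))⁻¹ with hu
  constructor
  · intro h1
    have h2 : cw * u * (A - Complex.I * B) = cw * u * ((k / 2 : ℂ) * Φ₀) := by
      linear_combination h1
    exact mul_left_cancel₀ (mul_ne_zero hcw0 hyu0) h2
  · intro hCR
    linear_combination (cw * u) * hCR

/-- **Holomorphy of the descent from the lowering-operator equation** (Gelbart 1997, (2.5.4) (v),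
converse direction; Bump 1997, §2.1, p. 130): if `F : GL₂(ℝ) → ℂ` is smooth in the archimedean
variable and `(E₁₁ F)(g_τ) - i (E₁₂ F)(g_τ) = (k/2) F(g_τ)` at every `g_τ = (y x; 0 1)`, then
`f_F = archDescent k F` is holomorphic on `ℍ`. [cite: Gelbart1997, (2.5.4) (v)]
[cite: Bump1997, Prop. 2.2.5 and §2.1 (p. 130)] -/
theorem mdifferentiable_archDescent {k : ℤ} {F : GL (Fin 2) ℝ → ℂ} (hs : IsArchSmooth incl F)
    (hCR : ∀ τ : ℍ, lieDeriv incl (toLie e₁₁) F (upperHalfPlaneToGL τ) -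
        Complex.I * lieDeriv incl (toLie e₁₂) F (upperHalfPlaneToGL τ) =
      (k / 2 : ℂ) * F (upperHalfPlaneToGL τ)) :
    MDifferentiable 𝓘(ℂ) 𝓘(ℂ) (archDescent k F) :=
  fun τ => (mdifferentiableAt_archDescent_iff hs τ).2 (hCR τ)



/-! ### One-parameter subgroups: scalars and rotations; the lowering operator for weight `k` -/

/-- The infinitesimal generator `W = (0 1; -1 0) = E₁₂ - E₂₁` of the rotations
(`exp(tW) = (cos t, sin t; -sin t, cos t)`, Bump 1997, (2.35)–(2.36)). [cite: Bump1997, (2.35)] -/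
def rotGen : Matrix (Fin 2) (Fin 2) ℝ := !![0, 1; -1, 0]

/-- `W = E₁₂ - E₂₁`. [folklore] -/
theorem rotGen_eq : rotGen = e₁₂ - e₂₁ := by
  ext i j
  fin_cases i <;> fin_cases j <;> simp [rotGen, e₁₂, e₂₁]

/-- `W² = -1`. [folklore] -/
theorem rotGen_mul_rotGen : rotGen * rotGen = -1 := by
  ext i j
  fin_cases i <;> fin_cases j <;> simp [rotGen, Matrix.mul_apply, Fin.sum_univ_two]

/-- `1 = E₁₁ + E₂₂` in `𝔤𝔩₂(ℝ)`. [folklore] -/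
theorem one_eq_e₁₁_add_e₂₂ : (1 : Matrix (Fin 2) (Fin 2) ℝ) = e₁₁ + e₂₂ := by
  ext i j
  fin_cases i <;> fin_cases j <;> simp [e₁₁, e₂₂]

set_option backward.isDefEq.respectTransparency false in
open scoped Matrix.Norms.Operator in
/-- **`exp(θW) = cos θ · 1 + sin θ · W`** for `W = (0 1; -1 0)` (`W² = -1`; sum the exponential
series over even and odd terms: Bump 1997, (2.36), "which one proves by simply multiplying out the
matrices in the Taylor expansion for `exp(tW)`"). [cite: Bump1997, (2.36)] -/
theorem exp_smul_rotGen (θ : ℝ) :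
    NormedSpace.exp (θ • rotGen) = Real.cos θ • (1 : Matrix (Fin 2) (Fin 2) ℝ) + Real.sin θ • rotGen := by
  have hsq : ∀ n : ℕ, rotGen ^ (2 * n) = ((-1 : ℝ) ^ n) • (1 : Matrix (Fin 2) (Fin 2) ℝ) := by
    intro n
    rw [pow_mul, sq, rotGen_mul_rotGen, ← neg_one_smul ℝ (1 : Matrix (Fin 2) (Fin 2) ℝ), smul_pow, one_pow]
  rw [NormedSpace.exp_eq_tsum ℝ]
  refine HasSum.tsum_eq ?_
  refine HasSum.even_add_odd ?_ ?_
  · refine ((Real.hasSum_cos θ).smul_const (1 : Matrix (Fin 2) (Fin 2) ℝ)).congr_fun fun n => ?_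
    rw [smul_pow, hsq, smul_smul, smul_smul]
    congr 1
    field_simp
  · refine ((Real.hasSum_sin θ).smul_const rotGen).congr_fun fun n => ?_
    rw [smul_pow, show rotGen ^ (2 * n + 1) = rotGen ^ (2 * n) * rotGen from pow_succ _ _, hsq,
      smul_mul_assoc, one_mul, smul_smul, smul_smul]
    congr 1
    field_simp

set_option backward.isDefEq.respectTransparency false in
open scoped Matrix.Norms.Operator in
/-- In `GL₂(ℝ)`: `exp(θW) = r(-θ)` with `r(θ) = (cos θ, -sin θ; sin θ, cos θ)` (`rotGL`).
[cite: Bump1997, (2.36)] -/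
theorem expGL_smul_rotGen (θ : ℝ) : expGL (θ • rotGen) = rotGL (-θ) := by
  refine Units.ext ?_
  rw [coe_expGL, exp_smul_rotGen]
  ext i j
  fin_cases i <;> fin_cases j <;>
    simp [rotGen, rotGL_apply_zero_zero, rotGL_apply_zero_one, rotGL_apply_one_zero,
      rotGL_apply_one_one, Real.cos_neg, Real.sin_neg]

set_option backward.isDefEq.respectTransparency false in
open scoped Matrix.Norms.Operator in
/-- `exp(t · 1) = e^t · 1` (`exp` commutes with `algebraMap ℝ`). [folklore] -/
theorem exp_smul_one (t : ℝ) :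
    NormedSpace.exp (t • (1 : Matrix (Fin 2) (Fin 2) ℝ)) = Real.exp t • (1 : Matrix (Fin 2) (Fin 2) ℝ) := by
  rw [← Algebra.algebraMap_eq_smul_one, ← NormedSpace.algebraMap_exp_comm t, Real.exp_eq_exp_ℝ,
    Algebra.algebraMap_eq_smul_one]

set_option backward.isDefEq.respectTransparency false in
open scoped Matrix.Norms.Operator in
/-- In `GL₂(ℝ)`: `exp(t · 1)` is the positive scalar `e^t · 1` (`realScalarGL`). [folklore] -/
theorem expGL_smul_one (t : ℝ) :
    expGL (t • (1 : Matrix (Fin 2) (Fin 2) ℝ)) = realScalarGL (Real.exp t) (Real.exp_pos t) := by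
  refine Units.ext ?_
  rw [coe_expGL, exp_smul_one, coe_realScalarGL]

/-- **Weight `k` functions are killed by the centre**: `(Z F)(g) = 0` on `GL₂(ℝ)⁺` for `Z = 1 ∈ 𝔤𝔩₂(ℝ)`
(`F(g e^t) = F(g)`, condition (iv)). [cite: Gelbart1997, (2.5.4) (iv)] -/
theorem lieDeriv_one_of_hasArchWeight {k : ℤ} {F : GL (Fin 2) ℝ → ℂ} (hF : HasArchWeight k F)
    {g : GL (Fin 2) ℝ} (hg : 0 < g.det.val) : lieDeriv incl (toLie 1) F g = 0 := by
  have h : (fun t : ℝ => F (g * incl ((RealMatrixGroup.gl ℝ (Fin 2)).expMem (t • toLie 1)))) =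
      fun _ => F g := by
    funext t
    change F (g * expGL (t • (1 : Matrix (Fin 2) (Fin 2) ℝ))) = F g
    rw [expGL_smul_one, hF.mul_realScalarGL hg]
  change deriv (fun t : ℝ => F (g * incl ((RealMatrixGroup.gl ℝ (Fin 2)).expMem (t • toLie 1)))) 0 = 0
  rw [h, deriv_const]

/-- **Weight `k` functions are eigenfunctions of `W`**: `(W F)(g) = ik F(g)` on `GL₂(ℝ)⁺`
(`F(g exp(θW)) = F(g r(-θ)) = e^{ikθ} F(g)`, condition (iii); Bump 1997, (2.33): `dH = -i ∂_θ`,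
`H = -iW`). [cite: Gelbart1997, (2.5.4) (iii)] [cite: Bump1997, (2.33)–(2.36)] -/
theorem lieDeriv_rotGen_of_hasArchWeight {k : ℤ} {F : GL (Fin 2) ℝ → ℂ} (hF : HasArchWeight k F)
    {g : GL (Fin 2) ℝ} (hg : 0 < g.det.val) :
    lieDeriv incl (toLie rotGen) F g = Complex.I * k * F g := by
  have h : (fun t : ℝ => F (g * incl ((RealMatrixGroup.gl ℝ (Fin 2)).expMem (t • toLie rotGen)))) =
      fun t : ℝ => F g * Complex.exp ((k : ℂ) * Complex.I * (t : ℂ)) := by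
    funext t
    change F (g * expGL (t • rotGen)) = _
    rw [expGL_smul_rotGen, hF.mul_rotGL hg, ← Complex.exp_int_mul]
    congr 1
    push_cast
    ring
  change deriv (fun t : ℝ => F (g * incl ((RealMatrixGroup.gl ℝ (Fin 2)).expMem (t • toLie rotGen)))) 0 = _
  rw [h]
  have hc : HasDerivAt (fun w : ℂ => Complex.exp ((k : ℂ) * Complex.I * w))
      (Complex.exp ((k : ℂ) * Complex.I * ((0 : ℝ) : ℂ)) * ((k : ℂ) * Complex.I * 1)) ((0 : ℝ) : ℂ) :=
    ((hasDerivAt_id ((0 : ℝ) : ℂ)).const_mul ((k : ℂ) * Complex.I)).cexp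
  have hd : HasDerivAt (fun t : ℝ => F g * Complex.exp ((k : ℂ) * Complex.I * (t : ℂ)))
      (F g * (Complex.exp ((k : ℂ) * Complex.I * ((0 : ℝ) : ℂ)) * ((k : ℂ) * Complex.I * 1))) 0 :=
    hc.comp_ofReal.const_mul (F g)
  rw [hd.deriv]
  simp only [Complex.ofReal_zero, mul_zero, Complex.exp_zero, mul_one, one_mul]
  ring

/-- Additivity of the Lie derivative in `X ∈ 𝔤𝔩₂(ℝ)` for archimedean-smooth `F` (linearity of the
differential of the slice). Borel–Jacquet 1979, §1.5. [folklore] -/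
theorem lieDeriv_toLie_add {F : GL (Fin 2) ℝ → ℂ} (hs : IsArchSmooth incl F)
    (M M' : Matrix (Fin 2) (Fin 2) ℝ) (g : GL (Fin 2) ℝ) :
    lieDeriv incl (toLie (M + M')) F g = lieDeriv incl (toLie M) F g + lieDeriv incl (toLie M') F g := by
  rw [lieDeriv_toLie_eq_fderiv hs, lieDeriv_toLie_eq_fderiv hs, lieDeriv_toLie_eq_fderiv hs, map_add]

/-- The Lie derivative in `X ∈ 𝔤𝔩₂(ℝ)` respects differences, for archimedean-smooth `F`. [folklore] -/
theorem lieDeriv_toLie_sub {F : GL (Fin 2) ℝ → ℂ} (hs : IsArchSmooth incl F)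
    (M M' : Matrix (Fin 2) (Fin 2) ℝ) (g : GL (Fin 2) ℝ) :
    lieDeriv incl (toLie (M - M')) F g = lieDeriv incl (toLie M) F g - lieDeriv incl (toLie M') F g := by
  rw [lieDeriv_toLie_eq_fderiv hs, lieDeriv_toLie_eq_fderiv hs, lieDeriv_toLie_eq_fderiv hs, map_sub]

/-- For `F` smooth of weight `k` on `GL₂(ℝ)⁺`: `(E₂₂ F)(g) = -(E₁₁ F)(g)` (`E₁₁ + E₂₂ = Z` kills `F`).
[cite: Gelbart1997, (2.5.4) (iv)] -/
theorem lieDeriv_e₂₂_of_hasArchWeight {k : ℤ} {F : GL (Fin 2) ℝ → ℂ} (hs : IsArchSmooth incl F)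
    (hF : HasArchWeight k F) {g : GL (Fin 2) ℝ} (hg : 0 < g.det.val) :
    lieDeriv incl (toLie e₂₂) F g = -lieDeriv incl (toLie e₁₁) F g := by
  have h := lieDeriv_one_of_hasArchWeight hF hg
  rw [one_eq_e₁₁_add_e₂₂, lieDeriv_toLie_add hs] at h
  linear_combination h

/-- For `F` smooth of weight `k` on `GL₂(ℝ)⁺`: `(E₂₁ F)(g) = (E₁₂ F)(g) - ik F(g)`
(`E₁₂ - E₂₁ = W` acts by `ik`). [cite: Gelbart1997, (2.5.4) (iii)] -/
theorem lieDeriv_e₂₁_of_hasArchWeight {k : ℤ} {F : GL (Fin 2) ℝ → ℂ} (hs : IsArchSmooth incl F)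
    (hF : HasArchWeight k F) {g : GL (Fin 2) ℝ} (hg : 0 < g.det.val) :
    lieDeriv incl (toLie e₂₁) F g = lieDeriv incl (toLie e₁₂) F g - Complex.I * k * F g := by
  have h := lieDeriv_rotGen_of_hasArchWeight hF hg
  rw [rotGen_eq, lieDeriv_toLie_sub hs] at h
  linear_combination -h

/-- **The lowering operator** of `𝔤𝔩₂(ℝ)_ℂ` acting on functions on `GL₂(ℝ)`, in Gelbart's
normalisation `X = (1 -i; -i -1) = Ĥ - i (R̂ + L̂)` (Gelbart 1997, (2.5.4) (v): "`X · φ = 0` where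
`X = (1 -i; -i -1)`"), i.e. twice Bump's `L = ½ (1 -i; -i -1)` (Bump 1997, (2.23)), as the
complexified derivation `(X F)(g) = ((E₁₁ - E₂₂) F)(g) - i ((E₁₂ F)(g) + (E₂₁ F)(g))`. A definition
(explicit arguments), not a named fact. [cite: Gelbart1997, (2.5.4) (v)] [cite: Bump1997, (2.23)] -/
def lowering (F : GL (Fin 2) ℝ → ℂ) (g : GL (Fin 2) ℝ) : ℂ :=
  lieDeriv incl (toLie (e₁₁ - e₂₂)) F g -
    Complex.I * (lieDeriv incl (toLie e₁₂) F g + lieDeriv incl (toLie e₂₁) F g)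

/-- Unfolding `lowering`. [cite: Gelbart1997, (2.5.4) (v)] -/
theorem lowering_apply (F : GL (Fin 2) ℝ → ℂ) (g : GL (Fin 2) ℝ) :
    lowering F g = lieDeriv incl (toLie (e₁₁ - e₂₂)) F g -
      Complex.I * (lieDeriv incl (toLie e₁₂) F g + lieDeriv incl (toLie e₂₁) F g) := rfl

/-- **The lowering operator on functions of weight `k`**: on `GL₂(ℝ)⁺`,
`(X F)(g) = 2 ((E₁₁ F)(g) - i (E₁₂ F)(g)) - k F(g)` — at `g = g_τ` this is Bump's
`dL = e^{-2iθ}(-iy ∂_x + y ∂_y - (1/2i) ∂_θ)` at `θ = 0` applied to `e^{ikθ} F` (Bump 1997, (2.32)),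
doubled. [cite: Bump1997, Prop. 2.2.5, (2.32)] -/
theorem lowering_eq_of_hasArchWeight {k : ℤ} {F : GL (Fin 2) ℝ → ℂ} (hs : IsArchSmooth incl F)
    (hF : HasArchWeight k F) {g : GL (Fin 2) ℝ} (hg : 0 < g.det.val) :
    lowering F g =
      2 * (lieDeriv incl (toLie e₁₁) F g - Complex.I * lieDeriv incl (toLie e₁₂) F g) - k * F g := by
  rw [lowering_apply, lieDeriv_toLie_sub hs, lieDeriv_e₂₂_of_hasArchWeight hs hF hg,
    lieDeriv_e₂₁_of_hasArchWeight hs hF hg]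
  linear_combination (k : ℂ) * F g * Complex.I_sq

/-- **Holomorphy of the descent ⟺ `X · F = 0` on the section** (Gelbart 1997, (2.5.4) (v); Bump
1997, Exercise 2.1.7 (a)–(b): a Maass form of weight `k` annihilated by the lowering operator is
`y^{k/2} f` with `f` holomorphic): for `F` smooth of weight `k`, `f_F` is complex-differentiable at
`τ` iff `(X F)(g_τ) = 0`. [cite: Gelbart1997, (2.5.4) (v)] [cite: Bump1997, Exercise 2.1.7] -/
theorem mdifferentiableAt_archDescent_iff_lowering {k : ℤ} {F : GL (Fin 2) ℝ → ℂ}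
    (hs : IsArchSmooth incl F) (hF : HasArchWeight k F) (τ : ℍ) :
    MDifferentiableAt 𝓘(ℂ) 𝓘(ℂ) (archDescent k F) τ ↔ lowering F (upperHalfPlaneToGL τ) = 0 := by
  rw [mdifferentiableAt_archDescent_iff hs, lowering_eq_of_hasArchWeight hs hF (det_upperHalfPlaneToGL_pos τ)]
  constructor
  · intro h; linear_combination 2 * h
  · intro h; linear_combination h / 2

/-- **`X · F = 0` on `GL₂(ℝ)⁺` implies that `f_F` is holomorphic** (Gelbart 1997, (2.5.4) (v),
converse direction). [cite: Gelbart1997, (2.5.4) (v)] -/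
theorem mdifferentiable_archDescent_of_lowering {k : ℤ} {F : GL (Fin 2) ℝ → ℂ}
    (hs : IsArchSmooth incl F) (hF : HasArchWeight k F)
    (hL : ∀ g : GL (Fin 2) ℝ, 0 < g.det.val → lowering F g = 0) :
    MDifferentiable 𝓘(ℂ) 𝓘(ℂ) (archDescent k F) :=
  fun τ => (mdifferentiableAt_archDescent_iff_lowering hs hF τ).2 (hL _ (det_upperHalfPlaneToGL_pos τ))

end GL2Real

/-! ### Boundedness on `GL₂(ℝ)⁺` and vanishing at the cusps -/

section Cusps

/-- **Slashing the descent** (`|det γ| = 1`, `det γ > 0`): for `F` of weight `k`,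
`f_F ∣[k] γ = f_{F(γ ·)}` — both sides have the same archimedean lift `g ↦ F(γ g)` on `GL₂(ℝ)⁺`
(`archLift_slash`, `archLift_archDescent`). Gelbart 1997, (2.5.4); Gelbart 1975, (3.5).
[cite: Gelbart1997, (2.5.4)] -/
theorem slash_archDescent_eq {k : ℤ} {F : GL (Fin 2) ℝ → ℂ} (hF : HasArchWeight k F)
    {γ : GL (Fin 2) ℝ} (hγ : γ.det.val = 1) :
    archDescent k F ∣[k] γ = archDescent k fun g => F (γ * g) := by
  have hγ' : |γ.det.val| = 1 := by rw [hγ, abs_one]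
  rw [← archDescent_archLift k (archDescent k F ∣[k] γ)]
  refine archDescent_congr k fun g hg => ?_
  have hg' : 0 < (γ * g).det.val := by rw [map_mul, Units.val_mul, hγ, one_mul]; exact hg
  rw [archLift_slash k _ hγ', archLift_archDescent hF hg']

/-- The norm of the descent: `‖f_F(τ)‖ = ‖F(g_τ)‖ (√y)^{-k}`. [folklore] -/
theorem norm_archDescent (k : ℤ) (F : GL (Fin 2) ℝ → ℂ) (τ : ℍ) :
    ‖archDescent k F τ‖ = ‖F (upperHalfPlaneToGL τ)‖ * Real.sqrt τ.im ^ (-k) := by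
  rw [archDescent_apply, norm_mul, ← Complex.ofReal_zpow, Complex.norm_real, Real.norm_eq_abs,
    abs_of_pos (zpow_pos (Real.sqrt_pos.2 τ.im_pos) _)]

/-- **A function bounded on `GL₂(ℝ)⁺` descends, in positive weight, to a function vanishing at
`i∞`**: `‖f_F(τ)‖ ≤ C (√y)^{-k} → 0` as `y → ∞` (`k > 0`). This is the remark that for
holomorphic forms of weight `k ≥ 1` the boundedness of `φ_f` on `G(𝔸)` (Gelbart 1975, Prop. 3.1
(vi) for cusp forms: "`φ_f` is bounded") already forces vanishing at every cusp.
[cite: Gelbart1975, Prop. 3.1] -/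
theorem isZeroAtImInfty_archDescent {k : ℤ} (hk : 0 < k) {F : GL (Fin 2) ℝ → ℂ} {C : ℝ}
    (hb : ∀ g : GL (Fin 2) ℝ, 0 < g.det.val → ‖F g‖ ≤ C) : IsZeroAtImInfty (archDescent k F) := by
  have hC : 0 ≤ C := (norm_nonneg _).trans (hb (upperHalfPlaneToGL UpperHalfPlane.I)
    (det_upperHalfPlaneToGL_pos _))
  -- `(√ im τ)^{-k} → 0` along `atImInfty`
  have h1 : Tendsto (fun τ : ℍ => Real.sqrt τ.im ^ (-k)) atImInfty (𝓝 0) := by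
    have him : Tendsto (fun τ : ℍ => τ.im) atImInfty atTop := Filter.tendsto_comap
    exact (tendsto_zpow_atTop_zero (neg_neg_of_pos hk)).comp (Real.tendsto_sqrt_atTop.comp him)
  have h2 : Tendsto (fun τ : ℍ => C * Real.sqrt τ.im ^ (-k)) atImInfty (𝓝 0) := by
    simpa using h1.const_mul C
  refine squeeze_zero_norm (fun τ => ?_) h2
  rw [norm_archDescent]
  exact mul_le_mul_of_nonneg_right (hb _ (det_upperHalfPlaneToGL_pos τ))
    (zpow_pos (Real.sqrt_pos.2 τ.im_pos) _).le

/-- **Vanishing at all cusps**: if `F` has weight `k > 0` and is bounded on `GL₂(ℝ)⁺`, then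
`f_F ∣[k] γ` vanishes at `i∞` for every `γ ∈ SL₂(ℤ)` (indeed for every `γ` of determinant `1`),
since `f_F ∣[k] γ = f_{F(γ ·)}` and `F(γ ·)` is again bounded. [cite: Gelbart1975, Prop. 3.1] -/
theorem isZeroAtImInfty_archDescent_slash {k : ℤ} (hk : 0 < k) {F : GL (Fin 2) ℝ → ℂ}
    (hF : HasArchWeight k F) {C : ℝ} (hb : ∀ g : GL (Fin 2) ℝ, 0 < g.det.val → ‖F g‖ ≤ C)
    {γ : GL (Fin 2) ℝ} (hγ : γ.det.val = 1) : IsZeroAtImInfty (archDescent k F ∣[k] γ) := by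
  rw [slash_archDescent_eq hF hγ]
  refine isZeroAtImInfty_archDescent hk (C := C) fun g hg => hb (γ * g) ?_
  rw [map_mul, Units.val_mul, hγ, one_mul]; exact hg

end Cusps

/-! ### The cusp form `f_φ ∈ S_k(Γ₁(N))` of an adelic function `φ` -/

section AdelicCuspForm

open NumberField IsDedekindDomain
open GL2Real

variable {N : ℕ} [NeZero N] {k : ℤ} {φ : GL (Fin 2) (AdeleRing (𝓞 ℚ) ℚ) → ℂ}

variable (N k) in
/-- **The classical cusp form `f_φ ∈ S_k(Γ₁(N))` of an adelic function `φ` on `GL₂(𝔸_ℚ)`**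
(Gelbart 1997, Prop. 2.5, sketch of proof: (2.5.4) read from right to left, i.e. the map `φ ↦ f_φ`
inverse to `f ↦ φ_f`; Gelbart 1975, Prop. 3.1 and §3.A; Bump 1997, §3.6). Hypotheses, in Gelbart's
numbering (2.5.4): (i) `φ(γ g) = φ(g)` for `γ ∈ GL₂(ℚ)`; (ii) `φ(g (1, h)) = φ(g)` for `h ∈ K₁(N)`;
(iii)–(iv) weight `k` at `∞` (`HasArchWeight k F_φ`, `F_φ = φ ∘ (g_∞ ↦ (g_∞, 1))`); (v)
`X · φ = 0` on `GL₂(ℝ)⁺ × {1}` for `X = (1 -i; -i -1)` (`GL2Real.lowering F_φ g = 0`,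
`mdifferentiable_archDescent_of_lowering`), for `F_φ` smooth in the archimedean variable; and, in
place of (vi)–(vii) (moderate growth and cuspidality), boundedness of
`φ` on `GL₂(ℝ)⁺ × {1}` — which for `k > 0` gives vanishing at every cusp
(`isZeroAtImInfty_archDescent_slash`) and which cusp forms on `GL₂(𝔸_ℚ)` enjoy (Gelbart 1975,
Prop. 3.1: "`φ_f` is bounded"; in the tree `AutomorphicRepsGL.cuspidal_bounded`). Conclusion:
`f_φ(τ) = φ((g_τ, 1)) (√y)^{-k}` is a cusp form of weight `k` and level `Γ₁(N)`.
[cite: Gelbart1997, Prop. 2.5 (sketch of proof, (2.5.4))] [cite: Gelbart1975, Prop. 3.1] -/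
def adelicDescentCuspForm (hk : 0 < k) (φ : GL (Fin 2) (AdeleRing (𝓞 ℚ) ℚ) → ℂ)
    (hleft : ∀ (γ : GL (Fin 2) ℚ) (g : GL (Fin 2) (AdeleRing (𝓞 ℚ) ℚ)), φ (GLn.ofGlobal 2 ℚ γ * g) = φ g)
    (hright : ∀ h ∈ gammaOneFiniteLevel ℚ (Ideal.span {(N : 𝓞 ℚ)}),
      ∀ g : GL (Fin 2) (AdeleRing (𝓞 ℚ) ℚ), φ (g * GLn.ofFinite 2 ℚ h) = φ g)
    (hweight : HasArchWeight k fun x => φ (Rat.ofRealGL 2 x))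
    (hsmooth : IsArchSmooth incl fun x => φ (Rat.ofRealGL 2 x))
    (hlow : ∀ x : GL (Fin 2) ℝ, 0 < x.det.val → lowering (fun x => φ (Rat.ofRealGL 2 x)) x = 0)
    (hbdd : ∃ C : ℝ, ∀ x : GL (Fin 2) ℝ, 0 < x.det.val → ‖φ (Rat.ofRealGL 2 x)‖ ≤ C) :
    CuspForm (CongruenceSubgroup.Gamma1 N) k where
  toSlashInvariantForm := adelicDescent N k φ hleft hright hweight
  holo' := mdifferentiable_archDescent_of_lowering hsmooth hweight hlow
  zero_at_cusps' := fun {c} hc => by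
    rw [Subgroup.IsArithmetic.isCusp_iff_isCusp_SL2Z] at hc
    rw [OnePoint.isZeroAt_iff_forall_SL2Z hc]
    intro A _
    obtain ⟨C, hC⟩ := hbdd
    rw [ModularForm.SL_slash]
    exact isZeroAtImInfty_archDescent_slash hk hweight hC (Rat.det_mapGL_real A)

/-- `f_φ(τ) = φ((g_τ, 1)) (√y)^{-k}` (definitional). [cite: Gelbart1997, (2.5.4)] -/
theorem adelicDescentCuspForm_apply (hk : 0 < k)
    (hleft : ∀ (γ : GL (Fin 2) ℚ) (g : GL (Fin 2) (AdeleRing (𝓞 ℚ) ℚ)), φ (GLn.ofGlobal 2 ℚ γ * g) = φ g)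
    (hright : ∀ h ∈ gammaOneFiniteLevel ℚ (Ideal.span {(N : 𝓞 ℚ)}),
      ∀ g : GL (Fin 2) (AdeleRing (𝓞 ℚ) ℚ), φ (g * GLn.ofFinite 2 ℚ h) = φ g)
    (hweight : HasArchWeight k fun x => φ (Rat.ofRealGL 2 x))
    (hsmooth : IsArchSmooth incl fun x => φ (Rat.ofRealGL 2 x))
    (hlow : ∀ x : GL (Fin 2) ℝ, 0 < x.det.val → lowering (fun x => φ (Rat.ofRealGL 2 x)) x = 0)
    (hbdd : ∃ C : ℝ, ∀ x : GL (Fin 2) ℝ, 0 < x.det.val → ‖φ (Rat.ofRealGL 2 x)‖ ≤ C) (τ : ℍ) :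
    adelicDescentCuspForm N k hk φ hleft hright hweight hsmooth hlow hbdd τ =
      φ (Rat.ofRealGL 2 (upperHalfPlaneToGL τ)) * ((Real.sqrt τ.im : ℝ) : ℂ) ^ (-k) :=
  rfl

/-- **`φ ↦ f_φ ↦ φ_{f_φ}` is the identity** on the cusp forms so obtained: the adelic lift of the
cusp form `f_φ` is `φ` (Gelbart 1997, Prop. 2.5, sketch: "the map `f ↦ φ_f` … is an isomorphism";
`adelicLiftFun_adelicDescent`). [cite: Gelbart1997, Prop. 2.5 (sketch of proof)] -/
theorem adelicLiftFun_adelicDescentCuspForm (hk : 0 < k)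
    (hleft : ∀ (γ : GL (Fin 2) ℚ) (g : GL (Fin 2) (AdeleRing (𝓞 ℚ) ℚ)), φ (GLn.ofGlobal 2 ℚ γ * g) = φ g)
    (hright : ∀ h ∈ gammaOneFiniteLevel ℚ (Ideal.span {(N : 𝓞 ℚ)}),
      ∀ g : GL (Fin 2) (AdeleRing (𝓞 ℚ) ℚ), φ (g * GLn.ofFinite 2 ℚ h) = φ g)
    (hweight : HasArchWeight k fun x => φ (Rat.ofRealGL 2 x))
    (hsmooth : IsArchSmooth incl fun x => φ (Rat.ofRealGL 2 x))
    (hlow : ∀ x : GL (Fin 2) ℝ, 0 < x.det.val → lowering (fun x => φ (Rat.ofRealGL 2 x)) x = 0)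
    (hbdd : ∃ C : ℝ, ∀ x : GL (Fin 2) ℝ, 0 < x.det.val → ‖φ (Rat.ofRealGL 2 x)‖ ≤ C) :
    adelicLiftFun N k (adelicDescentCuspForm N k hk φ hleft hright hweight hsmooth hlow hbdd) = φ :=
  adelicLiftFun_adelicDescent hleft hright hweight

end AdelicCuspForm

end Literature.NumberTheory.Automorphic

end
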